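import Summits.MatrixMultiplication.MatrixMultiplication.Theses.ThinBlockAlpha
import Summits.MatrixMultiplication.MatrixMultiplication.Theorems.BoundedExponentThird.Negative.TwoLegBound
import Summits.MatrixMultiplication.MatrixMultiplication.Theorems.BoundedExponentThird.Negative.CoherentFamilies
import Summits.MatrixMultiplication.MatrixMultiplication.Theorems.BoundedExponentThird.Negative.BlocksGrow

/-!
# Line `tame-charts` for the crux `ThinBlockAlpha.BoundedExponentThird` (stmt-MatrixMultiplication-10596)

Skeleton (crux-plan, round 1, 2026-08-16).  The idea card's lever made exact: a CKSU chart
(Cohn–Kleinberg–Szegedy–Umans 2005, Def. 36 / Thm. 37) over ONE small abelian group `Z` of exponent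
`≤ ℓ` — symbols `x ↦ (SA x, SB x, SC x) ⊆ Z`, each a TPP triple — whose long-leg pieces
`D x = SC x − SA x` TILE `Z`, which is THIN (`∏ b_x^{6 q_x} ≥ ∏ q_x^{q_x}`, `q_x = |SA x||SC x|`:
after symmetrisation the middle leg is `≥` the cube root of the outer leg), and which carries a
GORDAN RIGIDITY CERTIFICATE — integer potentials `φ₁ + φ₂ + φ₃ ≡ 0` on symbols, strictly positive on
every off-diagonal non-separating ("bad") coordinate pattern.  Rigidity makes the FULL composition
class `T(m·q)` of words a local chart-USP (stub 2), hence (CKSU Thm. 37, stub 1) an STPP family of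
product blocks in `Z^n`, `n = m|Z|`, with exponent `exp Z ≤ ℓ` for every `m`; the method of types
(`|T(m q)| ∏ q_x^{m q_x} ≥ |Z|^n / (n+1)^k`, tree `one_le_card_pow_mul_typeClassMass_self`) makes
the two-leg packing tight up to `poly(n) = N^{o(1)}` (stub 3, asymmetric outer legs allowed), and
the reversal-product symmetrisation `(A,B,C) × (−C,−B,−A)` (stub 4) lands in the crux's symmetric
slack levels `DesignAt ℓ η` (landed `Negative.TwoLegBound`, `boundedExponentThird_iff`).  So the
whole crux is reduced to ONE FINITE CERTIFICATE per group (stub 5, the card's C⁺ = `TameThinChart`):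
the composition `BoundedExponentThird_of` below is kernel-checked, `sorry` lives only in `stub_*`.

Stubs (registered; sizes are guesses):
* `stub_chartSTPP`      — CKSU Thm. 37 in the tree's `IsSTPP` threading (M, provable now; SHARED
                           with line null-offset-hashing-charts — land once).
* `stub_rigidClassUSP`  — Gordan potentials ⇒ every injective constant-type row family is a local
                           chart-USP (M⁻, provable now; the lever (R)).
* `stub_classDesigns`   — full-class STPP families of a tiling thin chart give asymmetric thin
                           designs at EVERY slack `η > 0` (method of types + `N = (∏ q^q)^m → ∞`;
                           M/L, provable now).
* `stub_symmetrise`     — `AsymDesignAt ℓ η → DesignAt ℓ (2η)` by reversal + product (M, provable now).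
* `stub_existsTameThinChart` — `∃ ℓ, TameThinChart ℓ`: ONE rigid thin tiling chart exists
                           (HARDEST; a finite LP/SAT-decidable statement per `(Z, k)`; `|Z| ≤ 9`
                           exhausted negative by the ideator, `|Z| ∈ [16,64]` untested; may be FALSE —
                           then "(R) + tiling + thin ⇒ False" is the Negative lemma that retires the line).

Disproof used (cdisprove `Cruxes/BoundedExponentThird/Disproof.lean`; landed `Negative/*`, imported
above so this scratch check sees them).  There is no `_false_without_` theorem for this crux (§5: it
RESISTS).  Honoured: `not_BoundedExponentThirdBoundedN` (blocks must grow) — stub 3 produces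
`N = (∏ q_x^{q_x})^m → ∞`; `not_designAt_zero` (η = 0 false) — the line only ever reaches slack
`poly(n) = N^{o(1)}`, never `η = 0`; `not_BoundedExponentThirdTranslateB / TranslateA / CosetLegs`
(no family of translates of one set, no common leg subgroup) — class designs permute the coordinate
factors `SB x` of DIFFERENT sizes (thinness forces B-fat symbols, tiling forces B-thin ones:
`rigid_top_isThin` below), so no two blocks' middle (or outer) sets are translates of each other and
the leg sets `∏ D_{w c}` are not cosets of one subgroup; `two_leg_bound` — consistent (`L = |T|` is
exponential in `n`, `M = poly-exp`).  Sanity lemmas proved here (sorry-free): rigidity excludes both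
twins of every twin pair and every all-bad Latin 3-cycle (`rigid_no_twin₁₂₃`, `rigid_no_latin`) —
the triage's structural squeeze, as guidance for the stub-5 hunt.
-/

noncomputable section

set_option linter.dupNamespace false

namespace Summit.MatrixMultiplication.MatrixMultiplication.Cruxes.BoundedExponentThird.TameCharts

open Finset Literature.Computability.AlgebraicComplexity
open Summit.MatrixMultiplication.MatrixMultiplication.Theses.ThinBlockAlpha (BoundedExponentThird)
open Summit.MatrixMultiplication.MatrixMultiplication.Theorems.BoundedExponentThird.Negative
  (DesignAt boundedExponentThird_iff)

/-! ## Chart vocabulary (CKSU 2005 Def. 36, in the index threading of the tree's `IsSTPP`) -/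

section Vocabulary

/-- Triple product property of ONE chart symbol `(A, B, C)` (CKSU Def. 2.1, additive, six elements
explicit as in the tree's `IsSTPP`, case `i = j = k`). -/
def SymbolTPP {Z : Type} [AddCommGroup Z] (A B C : Finset Z) : Prop :=
  ∀ a ∈ A, ∀ a' ∈ A, ∀ b ∈ B, ∀ b' ∈ B, ∀ c ∈ C, ∀ c' ∈ C,
    (a' - a) + (b' - b) + (c' - c) = 0 → a = a' ∧ b = b' ∧ c = c'

/-- The ordered symbol pattern `(x, y, z)` is BAD (non-separating) iff the `IsSTPP` relation has a
solution threaded through it exactly as the tree's `IsSTPP` threads indices `(i, j, k)`: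
`s' ∈ A i ↦ SA x`, `s ∈ A k ↦ SA z`, `t' ∈ B j ↦ SB y`, `t ∈ B i ↦ SB x`, `u' ∈ C k ↦ SC z`,
`u ∈ C j ↦ SC y`.  Equivalently `0 ∈ (SA x − SA z) + (SB y − SB x) + (SC z − SC y)`, i.e.
`D z ∩ ((SB x − SA x) + (SC y − SB y)) ≠ ∅`.  Every diagonal pattern `(x,x,x)` with nonempty sets is bad. -/
def Bad {Z : Type} [AddCommGroup Z] {k : ℕ} (SA SB SC : Fin k → Finset Z) (x y z : Fin k) : Prop :=
  ∃ s' ∈ SA x, ∃ s ∈ SA z, ∃ t' ∈ SB y, ∃ t ∈ SB x, ∃ u' ∈ SC z, ∃ u ∈ SC y,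
    (s' - s) + (t' - t) + (u' - u) = 0

/-- The product block `∏_c S (w c) ⊆ Z^n` of a word `w` (CKSU Thm. 37). -/
def block {Z : Type} {k n : ℕ} (S : Fin k → Finset Z) (w : Fin n → Fin k) : Finset (Fin n → Z) :=
  Fintype.piFinset fun c => S (w c)

/-- LOCAL CHART-USP (CKSU Def. 36 "local 𝒞-USP"): every index triple not all equal has a GOOD
(non-bad) coordinate.  (Forces `row` injective: a repeated row gives an all-diagonal triple.) -/
def IsLocalChartUSP {Z : Type} [AddCommGroup Z] {k : ℕ} (SA SB SC : Fin k → Finset Z) {n L : ℕ}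
    (row : Fin L → Fin n → Fin k) : Prop :=
  ∀ i j l : Fin L, ¬ (i = j ∧ j = l) → ∃ c : Fin n, ¬ Bad SA SB SC (row i c) (row j c) (row l c)

/-- GORDAN RIGIDITY CERTIFICATE (the lever (R) of the card): integer potentials on symbols with
`φ₁ + φ₂ + φ₃ ≡ 0`, strictly positive on every OFF-DIAGONAL bad pattern.  By LP duality (Gordan) it
exists iff no nonzero balanced measure lives on the off-diagonal bad patterns. -/
def IsRigid {Z : Type} [AddCommGroup Z] {k : ℕ} (SA SB SC : Fin k → Finset Z) : Prop :=
  ∃ φ₁ φ₂ φ₃ : Fin k → ℤ, (∀ x, φ₁ x + φ₂ x + φ₃ x = 0) ∧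
    ∀ x y z : Fin k, Bad SA SB SC x y z → ¬ (x = y ∧ y = z) → 0 < φ₁ x + φ₂ y + φ₃ z

/-- The word `w` has type (letter-count vector) `μ` — verbatim `letterCount w = μ` of
`Literature/…/WordTypes.lean` (`letterCount_apply`), i.e. `w ∈ typeClass n μ` (`mem_typeClass`). -/
def HasType {k n : ℕ} (w : Fin n → Fin k) (μ : Fin k → ℕ) : Prop :=
  ∀ x, (univ.filter fun c => w c = x).card = μ x

/-- Size of the long-leg piece `D x = SC x − SA x` (under `SymbolTPP` and `SB x ≠ ∅`): `q_x = a_x c_x`. -/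
def pieceSize {Z : Type} {k : ℕ} (SA SC : Fin k → Finset Z) (x : Fin k) : ℕ := (SA x).card * (SC x).card

/-- The long-leg pieces `D x = SC x − SA x` TILE `Z`: they cover `Z`, and a difference `c − a`
determines its symbol (cross-symbol disjointness; within a symbol `(a, c)` is then unique by
`SymbolTPP`).  This is exactly two-leg tightness `|Z^n| = L·N₁N₂·poly(n)` for the full class. -/
def PiecesTile {Z : Type} [AddCommGroup Z] {k : ℕ} (SA SC : Fin k → Finset Z) : Prop :=
  (∀ g : Z, ∃ x, ∃ a ∈ SA x, ∃ c ∈ SC x, c - a = g) ∧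
  (∀ x y, ∀ a ∈ SA x, ∀ c ∈ SC x, ∀ a' ∈ SA y, ∀ c' ∈ SC y, c - a = c' - a' → x = y)

/-- THINNESS `a_sym ≥ 1/3`: for the class `T(m q)` the symmetrised blocks are
`⟨(∏ q^q)^m, (∏ b^{2q})^m, (∏ q^q)^m⟩`, and `M ≥ N^{1/3}` reads `∏ q_x^{q_x} ≤ ∏ b_x^{6 q_x}`. -/
def ThinEnough {Z : Type} {k : ℕ} (SA SB SC : Fin k → Finset Z) : Prop :=
  ∏ x, pieceSize SA SC x ^ pieceSize SA SC x ≤ ∏ x, (SB x).card ^ (6 * pieceSize SA SC x)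

/-- A TAME THIN CHART over `Z` (the card's C⁺, per group): TPP symbols, tiling long-leg pieces, at
least one non-point piece (so `N → ∞`), thin, and Gordan-rigid.  A finite, exactly checkable
certificate (rational LP for the potentials). -/
def IsTameThinChart {Z : Type} [AddCommGroup Z] {k : ℕ} (SA SB SC : Fin k → Finset Z) : Prop :=
  (∀ x, SymbolTPP (SA x) (SB x) (SC x)) ∧ PiecesTile SA SC ∧ (∃ x, 2 ≤ pieceSize SA SC x) ∧
    ThinEnough SA SB SC ∧ IsRigid SA SB SC

end Vocabulary

/-- `TameThinChart ℓ`: some finite abelian group of exponent `≤ ℓ` carries a tame thin chart. -/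
def TameThinChart (ℓ : ℕ) : Prop :=
  ∃ (Z : Type) (_ : AddCommGroup Z) (_ : Fintype Z) (k : ℕ) (SA SB SC : Fin k → Finset Z),
    AddMonoid.exponent Z ≤ ℓ ∧ IsTameThinChart SA SB SC

/-- One slack level with ASYMMETRIC outer legs: an exponent-`≤ ℓ` abelian STPP family of blocks
`⟨N₁, M, N₂⟩` with `N₁N₂ ≥ 2`, `(N₁N₂)^{1/3} ≤ M²` and `|H| ≤ L·(N₁N₂)^{1+η}`.  (Its reversal-product
square is a `DesignAt ℓ (2η)`: `stub_symmetrise`.) -/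
def AsymDesignAt (ℓ : ℕ) (η : ℝ) : Prop :=
  ∃ (H : Type) (_ : AddCommGroup H) (_ : Fintype H) (L N₁ M N₂ : ℕ) (A B C : Fin L → Finset H),
    AddMonoid.exponent H ≤ ℓ ∧ IsSTPP A B C ∧
    (∀ i, (A i).card = N₁ ∧ (B i).card = M ∧ (C i).card = N₂) ∧ 2 ≤ N₁ * N₂ ∧
    ((N₁ * N₂ : ℕ) : ℝ) ^ (1 / 3 : ℝ) ≤ (M : ℝ) ^ 2 ∧
    (Fintype.card H : ℝ) ≤ L * ((N₁ * N₂ : ℕ) : ℝ) ^ (1 + η)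

/-! ## The five stub STATEMENTS (named `Prop`s; the registered `stub_*` theorems restate them verbatim,
`*_holds` certify the agreement definitionally, and `Registered.stub_*` are the name-keyed aliases used
as the hypotheses of `BoundedExponentThird_of` — the native skeleton audit admits a hypothesis by the
last name component of its head; same device as `Summits/ABC/ABC/Cruxes/SomeWindowSaving/Lines/`) -/

/-- STUB 1 statement — **CKSU 2005 Thm. 37** in the tree's threading: over a chart of TPP symbols,
every local chart-USP row family yields an `IsSTPP` family of product blocks in `Fin n → Z`.
Proof = the proof of `CohnKleinbergSzegedyUmans2005_thm33_holds` with "exactly one nonzero term at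
coordinate `c`" replaced by "the coordinate-`c` components solve `Bad (row i c) (row j c) (row l c)`". -/
def ChartSTPP : Prop :=
  ∀ (Z : Type) [AddCommGroup Z] (k : ℕ) (SA SB SC : Fin k → Finset Z),
    (∀ x, SymbolTPP (SA x) (SB x) (SC x)) →
    ∀ (n L : ℕ) (row : Fin L → Fin n → Fin k), IsLocalChartUSP SA SB SC row →
      IsSTPP (fun i => block SA (row i)) (fun i => block SB (row i)) (fun i => block SC (row i))

/-- STUB 2 statement — **rigidity makes every type class a code**: under a Gordan certificate, an
injective row family of constant type is a local chart-USP.  (Sum the potentials over the coordinates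
of a triple `(u, v, w)` of equal type: `Σ_c φ₁(u c) + φ₂(v c) + φ₃(w c) = Σ_x μ_x (φ₁+φ₂+φ₃)(x) = 0`;
if every coordinate were bad, each term is `≥ 0` (diagonal `= 0`, off-diagonal `> 0`), so all are
diagonal, `u = v = w`, and injectivity gives `i = j = l`.) -/
def RigidClassUSP : Prop :=
  ∀ (Z : Type) [AddCommGroup Z] (k : ℕ) (SA SB SC : Fin k → Finset Z), IsRigid SA SB SC →
    ∀ (n L : ℕ) (μ : Fin k → ℕ) (row : Fin L → Fin n → Fin k), Function.Injective row →
      (∀ i, HasType (row i) μ) → IsLocalChartUSP SA SB SC row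

/-- STUB 3 statement — **class designs** (the counting half of the transfer): if the full classes
`T(m·q)` (`q = pieceSize`) of a tiling thin chart over `Z` (exponent `≤ ℓ`) are STPP families of
product blocks, then for EVERY `η > 0` some class is an asymmetric thin design at slack `η`:
`H = Z^n`, `n = m|Z|`, `N₁N₂ = (∏ q^q)^m`, `M = (∏ b^q)^m`, `L = |T(mq)| ≥ |Z|^n ∏ q^{-mq} (n+1)^{-k}`
(`one_le_card_pow_mul_typeClassMass_self`, `card_typeClass_eq_multinomial`), and `(n+1)^k ≤ (N₁N₂)^η`
for `m ≥ m₀(η, |Z|, k)` because `∏ q^q ≥ 2`; exponent of `Fin n → Z` is `exp Z` (`AddMonoid.exponent_pi`). -/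
def ClassDesigns : Prop :=
  ∀ (ℓ : ℕ) (Z : Type) [AddCommGroup Z] [Fintype Z] (k : ℕ) (SA SB SC : Fin k → Finset Z),
    AddMonoid.exponent Z ≤ ℓ → (∀ x, SymbolTPP (SA x) (SB x) (SC x)) → PiecesTile SA SC →
    (∃ x, 2 ≤ pieceSize SA SC x) → ThinEnough SA SB SC →
    (∀ (m n L : ℕ) (row : Fin L → Fin n → Fin k), Function.Injective row →
      (∀ i, HasType (row i) fun x => m * pieceSize SA SC x) →
      IsSTPP (fun i => block SA (row i)) (fun i => block SB (row i)) (fun i => block SC (row i))) →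
    ∀ η : ℝ, 0 < η → AsymDesignAt ℓ η

/-- STUB 4 statement — **symmetrisation**: an asymmetric design `⟨N₁, M, N₂⟩` at slack `η` in `H`
gives the crux's symmetric level `DesignAt ℓ (2η)` in `H × H`: blocks
`(A i ×ˢ (−C j), B i ×ˢ (−B j), C i ×ˢ (−A j))`, `(i,j) ∈ Fin L × Fin L ≃ Fin (L·L)`, shape
`⟨N₁N₂, M², N₂N₁⟩`; the reversal `(A,B,C) ↦ (−C,−B,−A)` preserves `IsSTPP` (its relation with indices
`(i,j,k)` is the original relation with indices `(j,i,k)`), products by `AddSimultaneousTPP.prod` +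
`isSTPP_iff_addSimultaneousTPP` + `.comp`; `|H×H| = |H|² ≤ L²(N₁N₂)^{2+2η}`; `AddMonoid.exponent_prod`. -/
def Symmetrise : Prop :=
  ∀ (ℓ : ℕ) (η : ℝ), AsymDesignAt ℓ η → DesignAt ℓ (2 * η)

/-- STUB 5 statement — **the finite certificate exists**: some bounded-exponent abelian group carries
a tame thin chart (TPP symbols, tiling long-leg pieces, a non-point piece, `∏ q^q ≤ ∏ b^{6q}`, Gordan
rigidity).  OPEN and possibly FALSE; decidable per `(Z, k)` by exact rational LP. -/
def ExistsTameThinChart : Prop :=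
  ∃ ℓ : ℕ, TameThinChart ℓ

/-! ## The registered stubs (`sorry` lives only in these five theorems) -/

/-- **STUB 1 · `stub_chartSTPP`** — CKSU 2005 Thm. 37 (arXiv:math/0511460 p. 11) for the tree's
`IsSTPP` (= `ChartSTPP` verbatim).  Size M, provable now (template: `CohnKleinbergSzegedyUmans2005_thm33_holds`,
`Literature/…/LocalStrongUSP.lean`; `Fintype.mem_piFinset` for the blocks).  Shared first lemma of the
chart programme (cards null-offset-hashing-charts `isSTPP_of_localChartUSP`, tame-charts, entropy-defect). -/
theorem stub_chartSTPP :
    ∀ (Z : Type) [AddCommGroup Z] (k : ℕ) (SA SB SC : Fin k → Finset Z),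
      (∀ x, SymbolTPP (SA x) (SB x) (SC x)) →
      ∀ (n L : ℕ) (row : Fin L → Fin n → Fin k), IsLocalChartUSP SA SB SC row →
        IsSTPP (fun i => block SA (row i)) (fun i => block SB (row i)) (fun i => block SC (row i)) := by
  sorry

/-- **STUB 2 · `stub_rigidClassUSP`** — Gordan potentials ⇒ every injective constant-type row family
is a local chart-USP (= `RigidClassUSP` verbatim).  Size M⁻, provable now (fibrewise sums
`Finset.sum_comp` / `Finset.card_eq_sum_card_fiberwise`; the only subtlety is bookkeeping the
"all coordinates diagonal ⇒ rows equal ⇒ indices equal" step). -/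
theorem stub_rigidClassUSP :
    ∀ (Z : Type) [AddCommGroup Z] (k : ℕ) (SA SB SC : Fin k → Finset Z), IsRigid SA SB SC →
      ∀ (n L : ℕ) (μ : Fin k → ℕ) (row : Fin L → Fin n → Fin k), Function.Injective row →
        (∀ i, HasType (row i) μ) → IsLocalChartUSP SA SB SC row := by
  sorry

/-- **STUB 3 · `stub_classDesigns`** — full-class STPP families of a tiling thin chart give
asymmetric thin designs at every slack (= `ClassDesigns` verbatim).  Size M/L, provable now: method
of types (`Literature/…/MultinomialEntropy.lean` `one_le_card_pow_mul_typeClassMass_self`,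
`LaserMethodTypes.lean` `card_typeClass_eq_multinomial`, `typeClass_nonempty`), block cardinalities
`Fintype.card_piFinset`, `Σ_x q_x = |Z|` from `PiecesTile` + `SymbolTPP` (pieces of full size
`a_x c_x`, note `ThinEnough` forces `SB x ≠ ∅` whenever `q_x ≥ 1`), an enumeration
`Fin |T| ≃ T(mq)`, and the real-analysis step `(m|Z|+1)^k ≤ 2^{mη} ≤ (∏ q^q)^{mη}` for large `m`. -/
theorem stub_classDesigns :
    ∀ (ℓ : ℕ) (Z : Type) [AddCommGroup Z] [Fintype Z] (k : ℕ) (SA SB SC : Fin k → Finset Z),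
      AddMonoid.exponent Z ≤ ℓ → (∀ x, SymbolTPP (SA x) (SB x) (SC x)) → PiecesTile SA SC →
      (∃ x, 2 ≤ pieceSize SA SC x) → ThinEnough SA SB SC →
      (∀ (m n L : ℕ) (row : Fin L → Fin n → Fin k), Function.Injective row →
        (∀ i, HasType (row i) fun x => m * pieceSize SA SC x) →
        IsSTPP (fun i => block SA (row i)) (fun i => block SB (row i)) (fun i => block SC (row i))) →
      ∀ η : ℝ, 0 < η → AsymDesignAt ℓ η := by
  sorry

/-- **STUB 4 · `stub_symmetrise`** — `AsymDesignAt ℓ η → DesignAt ℓ (2η)` by reversal + product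
(= `Symmetrise` verbatim).  Size M, provable now (`isSTPP_iff_addSimultaneousTPP`,
`AddSimultaneousTPP.prod/.comp`, `finProdFinEquiv`, `Finset.card_product`, `Finset.card_map`,
`Fintype.card_prod`, `AddMonoid.exponent_prod`, `Real.rpow_natCast_mul` bookkeeping). -/
theorem stub_symmetrise : ∀ (ℓ : ℕ) (η : ℝ), AsymDesignAt ℓ η → DesignAt ℓ (2 * η) := by
  sorry

/-- **STUB 5 · `stub_existsTameThinChart`** — THE HARDEST STUB, the card's C⁺: one rigid thin tiling
chart in one bounded-exponent abelian group (= `ExistsTameThinChart` verbatim).  OPEN, finite per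
`(Z, k)`; status of the hunt (card + triage r1-1/2/3): `|Z| ≤ 9` exhausted with 0 rigid thin charts
(≈ 9 000 non-sharing + 800 000 sharing charts, exact rational LP), one-fat charts `ℓ ≤ 8` 0 certified;
`|Z| ∈ [16, 64]`, exponent 4/8/9, 4–6 symbols UNTESTED.  Necessary structure (proved in part below,
all in NOTES): the E-, F-, D-pieces of distinct symbols pairwise disjoint; the B-smear digraph
`x → z` (`D z ∩ (D x + (SB x − SB x) ∖ 0) ≠ ∅`) acyclic, every B-fat symbol has a successor, the
`φ₃`-top symbol is B-thin; no all-bad Latin 3-cycle.  It may be FALSE: "(R) ∧ PiecesTile ∧ some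
`|SB x| ≥ 2` ⇒ False" (triage r1-3) would be landed under `Theorems/BoundedExponentThird/Negative/`
and retires this line (the surviving hashing branch ψ³ is line null-offset-hashing-charts). -/
theorem stub_existsTameThinChart : ∃ ℓ : ℕ, TameThinChart ℓ := by
  sorry

/-! ### Consistency: each named statement IS its registered stub (definitionally) -/

theorem chartSTPP_holds : ChartSTPP := stub_chartSTPP
theorem rigidClassUSP_holds : RigidClassUSP := stub_rigidClassUSP
theorem classDesigns_holds : ClassDesigns := stub_classDesigns
theorem symmetrise_holds : Symmetrise := stub_symmetrise
theorem existsTameThinChart_holds : ExistsTameThinChart := stub_existsTameThinChart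

/-! ### Name-keyed aliases of the five statements (the hypotheses of the composition) -/
namespace Registered

/-- Alias of `ChartSTPP` keyed by the registered stub name. -/
abbrev stub_chartSTPP : Prop := ChartSTPP
/-- Alias of `RigidClassUSP` keyed by the registered stub name. -/
abbrev stub_rigidClassUSP : Prop := RigidClassUSP
/-- Alias of `ClassDesigns` keyed by the registered stub name. -/
abbrev stub_classDesigns : Prop := ClassDesigns
/-- Alias of `Symmetrise` keyed by the registered stub name. -/
abbrev stub_symmetrise : Prop := Symmetrise
/-- Alias of `ExistsTameThinChart` keyed by the registered stub name. -/
abbrev stub_existsTameThinChart : Prop := ExistsTameThinChart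

end Registered

/-! ## The composition: the five stubs imply the crux, BY NAME (kernel-checked; no `sorry` below) -/

/-- **`BoundedExponentThird_of`** — the glue of the line.  Take the tame thin chart of stub 5 over
`Z` (exponent `≤ ℓ`); by stubs 2 and 1 every full class `T(m·q)` is an STPP family of product
blocks; stub 3 turns these into asymmetric thin designs at slack `η/2` for every `η > 0`; stub 4
symmetrises to `DesignAt ℓ η`; `boundedExponentThird_iff` (landed `Negative.TwoLegBound`, `Iff.rfl`)
is the crux with witness `ℓ`. -/
theorem BoundedExponentThird_of (h₁ : Registered.stub_chartSTPP) (h₂ : Registered.stub_rigidClassUSP)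
    (h₃ : Registered.stub_classDesigns) (h₄ : Registered.stub_symmetrise)
    (h₅ : Registered.stub_existsTameThinChart) : BoundedExponentThird := by
  obtain ⟨ℓ, Z, _instZ, _finZ, k, SA, SB, SC, hexp, hT, hP, hfat, hthin, hR⟩ := h₅
  refine boundedExponentThird_iff.mpr ⟨ℓ, fun η hη => ?_⟩
  -- every full class of the rigid chart is an STPP family of product blocks (stubs 2, 1)
  have hclass : ∀ (m n L : ℕ) (row : Fin L → Fin n → Fin k), Function.Injective row →
      (∀ i, HasType (row i) fun x => m * pieceSize SA SC x) →
      IsSTPP (fun i => block SA (row i)) (fun i => block SB (row i)) (fun i => block SC (row i)) :=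
    fun m n L row hinj htyp =>
      h₁ Z k SA SB SC hT n L row (h₂ Z k SA SB SC hR n L _ row hinj htyp)
  -- asymmetric thin designs at slack η/2 (stub 3), symmetrised to slack η (stub 4)
  have hasym : AsymDesignAt ℓ (η / 2) :=
    h₃ ℓ Z k SA SB SC hexp hT hP hfat hthin hclass (η / 2) (by positivity)
  have hsym : DesignAt ℓ (2 * (η / 2)) := h₄ ℓ (η / 2) hasym
  rwa [show 2 * (η / 2) = η by ring] at hsym

/-- Wiring check: the registered stubs feed `BoundedExponentThird_of` as stated (the verbatim
restatements are definitionally the named statements). -/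
example : BoundedExponentThird :=
  BoundedExponentThird_of stub_chartSTPP stub_rigidClassUSP stub_classDesigns stub_symmetrise
    stub_existsTameThinChart

/-! ## Sanity lemmas (sorry-free): what rigidity forces — the structural squeeze of triage r1-2/r1-3,
as guidance for the stub-5 hunt.  (R) kills both members of every twin pair and every all-bad Latin
3-cycle; with `PiecesTile` the B-smear of a B-fat symbol lands in other pieces, so the `φ₃`-maximal
symbol is B-thin. -/

section Sanity

variable {Z : Type} [AddCommGroup Z] {k : ℕ} {SA SB SC : Fin k → Finset Z}

/-- Twin pairs `(x,y,y)`/`(y,x,x)` cannot both be bad under rigidity (`E`-pieces `SB − SA` of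
distinct symbols are disjoint). -/
theorem rigid_no_twin₁ (hR : IsRigid SA SB SC) {x y : Fin k} (hxy : x ≠ y)
    (h₁ : Bad SA SB SC x y y) (h₂ : Bad SA SB SC y x x) : False := by
  obtain ⟨φ₁, φ₂, φ₃, hsum, hpos⟩ := hR
  have a := hpos x y y h₁ (fun h => hxy h.1)
  have b := hpos y x x h₂ (fun h => hxy h.1.symm)
  have := hsum x
  have := hsum y
  omega

/-- Twin pairs `(x,x,y)`/`(y,y,x)` cannot both be bad under rigidity (`D`-pieces disjoint). -/
theorem rigid_no_twin₃ (hR : IsRigid SA SB SC) {x y : Fin k} (hxy : x ≠ y)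
    (h₁ : Bad SA SB SC x x y) (h₂ : Bad SA SB SC y y x) : False := by
  obtain ⟨φ₁, φ₂, φ₃, hsum, hpos⟩ := hR
  have a := hpos x x y h₁ (fun h => hxy h.2)
  have b := hpos y y x h₂ (fun h => hxy h.2.symm)
  have := hsum x
  have := hsum y
  omega

/-- Twin pairs `(x,y,x)`/`(y,x,y)` cannot both be bad under rigidity (`F`-pieces `SC − SB` disjoint). -/
theorem rigid_no_twin₂ (hR : IsRigid SA SB SC) {x y : Fin k} (hxy : x ≠ y)
    (h₁ : Bad SA SB SC x y x) (h₂ : Bad SA SB SC y x y) : False := by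
  obtain ⟨φ₁, φ₂, φ₃, hsum, hpos⟩ := hR
  have a := hpos x y x h₁ (fun h => hxy h.1)
  have b := hpos y x y h₂ (fun h => hxy h.1.symm)
  have := hsum x
  have := hsum y
  omega

/-- No all-bad Latin 3-cycle `(x,y,z), (y,z,x), (z,x,y)` under rigidity (the obstruction that kills
the "signed halves" and strong-USP charts: cyclic coordinate permutations of one row). -/
theorem rigid_no_latin (hR : IsRigid SA SB SC) {x y z : Fin k} (hxy : x ≠ y)
    (h₁ : Bad SA SB SC x y z) (h₂ : Bad SA SB SC y z x) (h₃ : Bad SA SB SC z x y) : False := by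
  obtain ⟨φ₁, φ₂, φ₃, hsum, hpos⟩ := hR
  have a := hpos x y z h₁ (fun h => hxy h.1)
  have b := hpos y z x h₂ (fun h => hxy (h.1.trans h.2).symm)
  have c := hpos z x y h₃ (fun h => hxy h.2)
  have := hsum x
  have := hsum y
  have := hsum z
  omega

/-- The B-smear mechanism at chart level (Disproof §1 `translate_not_mem`, one symbol): if the pieces
tile and `SB x` has two distinct elements, then some OTHER symbol `z ≠ x` has `Bad x x z` — so under
rigidity `φ₃ z > φ₃ x`: every B-fat symbol has a `φ₃`-successor, and the `φ₃`-top symbol is B-thin. -/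
theorem exists_bad_of_two_middle (hT : ∀ x, SymbolTPP (SA x) (SB x) (SC x)) (hP : PiecesTile SA SC)
    {x : Fin k} {a c t t' : Z} (ha : a ∈ SA x) (hc : c ∈ SC x) (ht : t ∈ SB x) (ht' : t' ∈ SB x)
    (htt' : t ≠ t') : ∃ z, z ≠ x ∧ Bad SA SB SC x x z := by
  -- the translate (c - a) + (t' - t) of the piece element c - a lies in some piece D z
  obtain ⟨z, a', ha', c', hc', he⟩ := hP.1 ((c - a) + (t' - t))
  have e0 : (a - a') + (t - t') + (c' - c) = 0 := by
    rw [show (a - a') + (t - t') + (c' - c) = (c' - a') - ((c - a) + (t' - t)) by abel, he, sub_self]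
  refine ⟨z, ?_, a, ha, a', ha', t, ht, t', ht', c', hc', c, hc, e0⟩
  -- z = x is impossible: within one symbol the TPP forbids a nonzero middle difference
  intro hzx
  rw [hzx] at ha' hc'
  have key := hT x a' ha' a ha t' ht' t ht c hc c' hc' e0
  exact htt' key.2.1.symm

/-- Under rigidity and tiling, the `φ₃`-maximal symbol is B-thin: a B-fat symbol has a strict
`φ₃`-successor. -/
theorem rigid_top_isThin (hT : ∀ x, SymbolTPP (SA x) (SB x) (SC x)) (hP : PiecesTile SA SC)
    {φ₁ φ₂ φ₃ : Fin k → ℤ} (hsum : ∀ x, φ₁ x + φ₂ x + φ₃ x = 0)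
    (hpos : ∀ x y z : Fin k, Bad SA SB SC x y z → ¬ (x = y ∧ y = z) → 0 < φ₁ x + φ₂ y + φ₃ z)
    {x : Fin k} {a c t t' : Z} (ha : a ∈ SA x) (hc : c ∈ SC x) (ht : t ∈ SB x) (ht' : t' ∈ SB x)
    (htt' : t ≠ t') : ∃ z, φ₃ x < φ₃ z := by
  obtain ⟨z, hzx, hbad⟩ := exists_bad_of_two_middle hT hP ha hc ht ht' htt'
  refine ⟨z, ?_⟩
  have h := hpos x x z hbad (fun h => hzx h.2.symm)
  have := hsum x
  omega

end Sanity

end Summit.MatrixMultiplication.MatrixMultiplication.Cruxes.BoundedExponentThird.TameCharts
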